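import Summits.CriticalPhenomena.PercolationContinuityZ3.Theorems.PercNearOneGluingNoHeavyLowerTailSahiHittingWidthThree
import Literature.Probability.Percolation.SelfRefinementMeasure
import Literature.Probability.Percolation.ConditionalPositiveAssociationProofs
import Literature.Combinatorics.Sahi2008.MeasureFunctional
import HarnessLib

/-!
# `NoHeavyLowerTail` (stmt-CriticalPhenomena-4575) — hitting families on ANY product space: the finite-coordinate bridge, and
# Sahi positivity at every order for width ≤ 3 over an arbitrary index type

Support file, seat `prim-l12-p5` (gen 7), `--supports stmt-CriticalPhenomena-4575`.  No definitions, no named facts, no sorries.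

The every-order theorems of `…SahiHittingWidthThree` are stated for the product weight `bernoulliWeight p` on `2^ι` with `ι`
FINITE (Sahi's finite functional `sahiE`).  Here the index type `ι` is arbitrary (e.g. the edge set of an infinite graph): the
measure is the product Bernoulli measure `prodBernoulli p` on `Set ι` and the functional is the measure-level `msahiE` of
`Literature/Combinatorics/Sahi2008/MeasureFunctional.lean` (the Lieb–Sahi recursion with integrals).

* **`msahiE_prodBernoulli_hit_eq_sahiE`** (the bridge): for finite sets `A_l ⊆ K` (`K` a finite set of coordinates),
  `E_m^{prodBernoulli p}(1_{H_{A_0}}, …, 1_{H_{A_{m−1}}})` equals the finite functional `sahiE (bernoulliWeight (p|_K)) m` of the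
  hitting events of the same sets read inside `2^K` — restriction `ω ↦ K ∩ ω` pushes `prodBernoulli p` to `prodBernoulli (p|_K)`
  (`prodBernoulli_map_preimage`) and pulls the hitting events of `2^K` back to those of `2^ι`; all joint moments agree
  (`msahiE_eq_sahiE_of_moments`).
* **`msahiE_prodBernoulli_hit_nonneg_of_width_le_three`**: on ANY product space, a finite family of hitting events of finite sets
  in which any four indices contain a nested pair (`A i ⊆ A j`) has `E_m ≥ 0` at every order `m`; in particular any three finite sets
  with arbitrary multiplicities (`…_of_three_sets`) and chains.
-/

noncomputable section

namespace Summit.CriticalPhenomena.PercolationContinuityZ3.Theorems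

namespace SahiHitting

open MeasureTheory Finset Function Literature.Combinatorics.Sahi2008
open Literature.Probability.Percolation (prodBernoulli_map_preimage)
open Literature.Probability.Percolation.BHK2006 (integral_prodBernoulli_eq_sum)
open Literature.Probability.Percolation.DecisionTree (ind ind_of_mem ind_of_not_mem ind_nonneg)
open Literature.Probability.LatticeModels (prodBernoulli)

variable {ι : Type*}

/-- Restriction of a configuration to the finite coordinate set `K`, as a configuration of `2^K`. [folklore] -/
theorem measurable_restrictToFinset (K : Finset ι) :
    Measurable (fun S : Set ι => (Subtype.val : K → ι) ⁻¹' S) :=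
  measurable_set_iff.2 fun a => measurable_set_mem (a : ι)

section Bridge

variable [DecidableEq ι]

/-- The hitting event of `A ⊆ K` in `2^ι` is the pull-back, under restriction to `K`, of the hitting event of `A` read in `2^K`.
[folklore] -/
theorem ind_hit_eq_ind_hit_restrict (K : Finset ι) (A : Finset ι) (hA : A ⊆ K) (S : Set ι) :
    ind {ω : Set ι | ∃ a ∈ A, a ∈ ω} S
      = ind {ω : Set K | ∃ a ∈ A.subtype (· ∈ K), a ∈ ω} ((Subtype.val : K → ι) ⁻¹' S) := by
  by_cases h : ∃ a ∈ A, a ∈ S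
  · obtain ⟨a, ha, haS⟩ := h
    rw [ind_of_mem (show S ∈ {ω : Set ι | ∃ a ∈ A, a ∈ ω} from ⟨a, ha, haS⟩),
      ind_of_mem (show (Subtype.val : K → ι) ⁻¹' S ∈ {ω : Set K | ∃ a ∈ A.subtype (· ∈ K), a ∈ ω} from
        ⟨⟨a, hA ha⟩, by simpa [Finset.mem_subtype] using ha, by simpa using haS⟩)]
  · rw [ind_of_not_mem (show S ∉ {ω : Set ι | ∃ a ∈ A, a ∈ ω} from h),
      ind_of_not_mem (show (Subtype.val : K → ι) ⁻¹' S ∉ {ω : Set K | ∃ a ∈ A.subtype (· ∈ K), a ∈ ω} from by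
        rintro ⟨a, ha, haS⟩
        exact h ⟨a, by simpa [Finset.mem_subtype] using ha, by simpa using haS⟩)]

/-- **The finite-coordinate bridge.**  For finite sets `A_l ⊆ K`, Sahi's functional of the hitting events `H_{A_l}` under
`prodBernoulli p` on `Set ι` (ANY `ι`) equals the finite functional of the hitting events of the same sets inside `2^K` under the
product weight with parameters `p|_K`. [this work] -/
theorem msahiE_prodBernoulli_hit_eq_sahiE (p : ι → unitInterval) (K : Finset ι) (m : ℕ) (A : Fin m → Finset ι)
    (hA : ∀ l, A l ⊆ K) :
    msahiE (prodBernoulli p) m (fun l => ind {ω : Set ι | ∃ a ∈ A l, a ∈ ω})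
      = sahiE (bernoulliWeight (fun a : K => p a)) m
          (fun l => ind {ω : Set K | ∃ a ∈ (A l).subtype (· ∈ K), a ∈ ω}) := by
  classical
  set π : Set ι → Set K := fun S => (Subtype.val : K → ι) ⁻¹' S with hπ
  set g' : Fin m → Set K → ℝ := fun l => ind {ω : Set K | ∃ a ∈ (A l).subtype (· ∈ K), a ∈ ω} with hg'
  have hmeasπ : Measurable π := measurable_restrictToFinset K
  have hmap : (prodBernoulli p).map π = prodBernoulli (fun a : K => p a) :=
    prodBernoulli_map_preimage p Subtype.val_injective
  refine msahiE_eq_sahiE_of_moments _ _ _ g' fun S => ?_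
  -- the joint moment of the sub-family `S`
  have hcomp : (∏ i ∈ S, (fun l => ind {ω : Set ι | ∃ a ∈ A l, a ∈ ω}) i) = (∏ i ∈ S, g' i) ∘ π := by
    funext ω
    simp only [Finset.prod_apply, Function.comp_apply, hg']
    exact Finset.prod_congr rfl fun i _ => ind_hit_eq_ind_hit_restrict K (A i) (hA i) ω
  rw [hcomp]
  have h1 : ∫ x, ((∏ i ∈ S, g' i) ∘ π) x ∂(prodBernoulli p) = ∫ y, (∏ i ∈ S, g' i) y ∂((prodBernoulli p).map π) := by
    rw [integral_map hmeasπ.aemeasurable (Measurable.of_discrete.aestronglyMeasurable)]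
    rfl
  rw [h1, hmap, integral_prodBernoulli_eq_sum]
  rfl

/-- Nestedness passes to the restricted sets. [folklore] -/
theorem subtype_subset_subtype_of_subset {K A B : Finset ι} (h : A ⊆ B) :
    A.subtype (· ∈ K) ⊆ B.subtype (· ∈ K) := by
  intro a ha
  rw [Finset.mem_subtype] at ha ⊢
  exact h ha

end Bridge

/-- **Sahi positivity at every order, width ≤ 3, ANY product space.**  For an arbitrary index type `ι`, `p : ι → [0,1]` and finite
sets `A : Fin m → Finset ι` such that among any four indices two carry nested sets,
`0 ≤ E_m^{prodBernoulli p}(1_{H_{A_0}}, …, 1_{H_{A_{m−1}}})` (`H_A = {ω | ∃ a ∈ A, a ∈ ω}`). [this work] -/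
theorem msahiE_prodBernoulli_hit_nonneg_of_width_le_three (p : ι → unitInterval) (m : ℕ) (A : Fin m → Finset ι)
    (hw : ∀ S : Finset (Fin m), S.card = 4 → ∃ i ∈ S, ∃ j ∈ S, i ≠ j ∧ A i ⊆ A j) :
    0 ≤ msahiE (prodBernoulli p) m (fun l => ind {ω : Set ι | ∃ a ∈ A l, a ∈ ω}) := by
  classical
  let K : Finset ι := Finset.univ.biUnion A
  have hA : ∀ l, A l ⊆ K := fun l => Finset.subset_biUnion_of_mem A (Finset.mem_univ l)
  rw [msahiE_prodBernoulli_hit_eq_sahiE p K m A hA]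
  refine prodBernoulli_sahiE_hit_nonneg_of_width_le_three _ m _ fun S hS => ?_
  obtain ⟨i, hi, j, hj, hij, hsub⟩ := hw S hS
  exact ⟨i, hi, j, hj, hij, subtype_subset_subtype_of_subset hsub⟩

/-- **Any three finite sets, arbitrary multiplicities, ANY product space**: `0 ≤ E_m(1_{H_{B_{c 0}}}, …, 1_{H_{B_{c (m−1)}}})` for
`B : Fin 3 → Finset ι` and any `c : Fin m → Fin 3`. [this work] -/
theorem msahiE_prodBernoulli_hit_nonneg_of_three_sets (p : ι → unitInterval) (B : Fin 3 → Finset ι) (m : ℕ)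
    (c : Fin m → Fin 3) :
    0 ≤ msahiE (prodBernoulli p) m (fun l => ind {ω : Set ι | ∃ a ∈ B (c l), a ∈ ω}) := by
  refine msahiE_prodBernoulli_hit_nonneg_of_width_le_three p m (fun l => B (c l)) fun S hS => ?_
  have hlt : (Finset.univ : Finset (Fin 3)).card < S.card := by simp [hS]
  obtain ⟨i, hi, j, hj, hij, hc⟩ := Finset.exists_ne_map_eq_of_card_lt_of_maps_to hlt (f := c) fun _ _ => Finset.mem_univ _
  exact ⟨i, hi, j, hj, hij, by simp [hc]⟩

/-- **Chains of finite sets, ANY product space, every order.** [this work] -/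
theorem msahiE_prodBernoulli_hit_nonneg_of_chain (p : ι → unitInterval) (m : ℕ) (A : Fin m → Finset ι) (hA : Monotone A) :
    0 ≤ msahiE (prodBernoulli p) m (fun l => ind {ω : Set ι | ∃ a ∈ A l, a ∈ ω}) := by
  refine msahiE_prodBernoulli_hit_nonneg_of_width_le_three p m A fun S hS => ?_
  obtain ⟨i, hi, j, hj, hij⟩ := Finset.one_lt_card.mp (by omega : 1 < S.card)
  rcases lt_or_gt_of_ne hij with h | h
  · exact ⟨i, hi, j, hj, hij, hA h.le⟩
  · exact ⟨j, hj, i, hi, hij.symm, hA h.le⟩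

end SahiHitting

end Summit.CriticalPhenomena.PercolationContinuityZ3.Theorems
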